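import Literature.MathematicalPhysics.QuantumLattice.GibbsLinearResponse
import Literature.MathematicalPhysics.QuantumLattice.GibbsTwoTimeBound
import Literature.MathematicalPhysics.QuantumLattice.ApproximatingHamiltonianProofs
import Mathlib.Analysis.Calculus.Deriv.MeanValue
import HarnessLib

/-!
# Gibbs expectations are Lipschitz in the Hamiltonian: `|⟨O⟩_{β,H+V} - ⟨O⟩_{β,H}| ≤ 2β ‖V‖ ‖O‖`

For Hermitian `H`, `V` on a finite-dimensional space, inverse temperature `β ≥ 0` and any observable
`O`, the finite-volume Gibbs state `⟨O⟩_{β,K} = Tr(e^{-βK} O)/Tr e^{-βK}` (`Matrix.gibbsState`) obeys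

* `Matrix.norm_duhamel_le` — the Duhamel two-point function is bounded by the operator norms,
  `‖(A, B)_Duh‖ ≤ ‖A‖ ‖B‖` (average over `s ∈ [0,1]` of the two-time bound
  `|Tr(e^{-(1-s)βH} A e^{-sβH} B)| ≤ ‖A‖‖B‖ Z` of `GibbsTwoTimeBound`);
* `Matrix.hasDerivAt_gibbsState_add_smul_real_at` — the Kubo–Duhamel linear-response formula
  (`GibbsLinearResponse`) at an arbitrary real coupling `t₀` (translate the base point);
* **`Matrix.norm_gibbsState_add_sub_gibbsState_le`** — the perturbation (Lipschitz) bound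
  `‖⟨O⟩_{β,H+V} - ⟨O⟩_{β,H}‖ ≤ 2 β ‖V‖ ‖O‖`: integrate the derivative along `t ↦ H + tV`,
  `t ∈ [0,1]`, whose norm is `≤ β (‖(O,V)_Duh‖ + ‖⟨O⟩‖‖⟨V⟩‖) ≤ 2β‖O‖‖V‖`.

So a perturbation of operator norm `o(1/β)` moves every Gibbs expectation by `o(‖O‖)` — e.g. at the
log-cold scale `β = κ log L` a global term of norm `o(1/log L)` is invisible at leading order.
Everything is PROVED; no definition.

## References

* O. Bratteli, D. W. Robinson, *Operator Algebras and Quantum Statistical Mechanics II*, 2nd ed.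
  (1997), §5.4.1 (perturbation expansion of KMS states; the first-order term is the Duhamel
  function), Prop. 5.4.1. [BratteliRobinsonII1997]
* F. J. Dyson, E. H. Lieb, B. Simon, J. Stat. Phys. 18 (1978) 335, eq. (5). [DLS1978]
-/

noncomputable section

open scoped Matrix.Norms.L2Operator ComplexOrder
open MeasureTheory intervalIntegral Filter NormedSpace
open Literature.MathematicalPhysics.QuantumLattice

namespace Matrix

variable {m : Type*} [Fintype m] [DecidableEq m]

/-! ### The Duhamel two-point function is bounded by the operator norms -/

/-- **`‖(A, B)_Duh‖ ≤ ‖A‖ ‖B‖`** for the Duhamel two-point function of the Gibbs state of a Hermitian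
`H` at `β ≥ 0`: each value of the integrand `Tr(A e^{-sβH} B e^{-(1-s)βH}) = Tr(e^{-(β-sβ)H} A e^{-sβH} B)`,
`s ∈ [0,1]`, is bounded by `‖A‖‖B‖ Z` (`norm_trace_gibbsWeight_mul_mul_gibbsWeight_mul_le`, the
matrix Hölder inequality). [cite: BratteliRobinsonII1997, Prop. 5.4.1] -/
theorem norm_duhamel_le {H : Matrix m m ℂ} (hH : H.IsHermitian) [Nonempty m] {β : ℝ} (hβ : 0 ≤ β)
    (A B : Matrix m m ℂ) : ‖duhamel β H A B‖ ≤ ‖A‖ * ‖B‖ := by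
  have hZre : 0 < (partitionFn β H).re := by
    rw [hH.partitionFn_eq_ofReal, Complex.ofReal_re]; exact hH.sum_exp_pos β
  have hZ : partitionFn β H = ((partitionFn β H).re : ℂ) := by
    rw [hH.partitionFn_eq_ofReal, Complex.ofReal_re]
  -- pointwise bound on the integrand
  have hpt : ∀ s ∈ Set.uIoc (0 : ℝ) 1,
      ‖(A * gibbsWeight (s * β) H * B * gibbsWeight ((1 - s) * β) H).trace‖ ≤
        ‖A‖ * ‖B‖ * (partitionFn β H).re := by
    intro s hs
    rw [Set.uIoc_of_le zero_le_one] at hs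
    have h0 : 0 ≤ s * β := mul_nonneg hs.1.le hβ
    have h1 : s * β ≤ β := by nlinarith [hs.2]
    have hcyc : (A * gibbsWeight (s * β) H * B * gibbsWeight ((1 - s) * β) H).trace =
        (gibbsWeight (β - s * β) H * A * gibbsWeight (s * β) H * B).trace := by
      rw [Matrix.trace_mul_comm, show (1 - s) * β = β - s * β by ring, ← Matrix.mul_assoc,
        ← Matrix.mul_assoc]
    rw [hcyc]
    exact norm_trace_gibbsWeight_mul_mul_gibbsWeight_mul_le hH h0 h1 A B
  have hint := intervalIntegral.norm_integral_le_of_norm_le_const (a := (0 : ℝ)) (b := 1) hpt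
  rw [sub_zero, abs_one, mul_one] at hint
  rw [duhamel, norm_mul, norm_inv, hZ, Complex.norm_real, Real.norm_of_nonneg hZre.le]
  calc ((partitionFn β H).re)⁻¹ *
        ‖∫ s in (0 : ℝ)..1, (A * gibbsWeight (s * β) H * B * gibbsWeight ((1 - s) * β) H).trace‖
      ≤ ((partitionFn β H).re)⁻¹ * (‖A‖ * ‖B‖ * (partitionFn β H).re) :=
        mul_le_mul_of_nonneg_left hint (inv_nonneg.mpr hZre.le)
    _ = ‖A‖ * ‖B‖ := by field_simp

/-! ### Linear response at an arbitrary coupling -/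

/-- The Kubo–Duhamel linear-response formula at an arbitrary real coupling `t₀`: for Hermitian `H`,
`V`, `t ↦ ⟨O⟩_{β, H + tV}` has derivative `-β [(O, V)_Duh - ⟨O⟩⟨V⟩]` at `t₀`, all states being those
of `H + t₀ V` (translate the base point in `hasDerivAt_gibbsState_add_smul_real`).
[cite: BratteliRobinsonII1997, §5.4.1] -/
theorem hasDerivAt_gibbsState_add_smul_real_at {H V : Matrix m m ℂ} (hH : H.IsHermitian)
    (hV : V.IsHermitian) [Nonempty m] (β t₀ : ℝ) (O : Matrix m m ℂ) :
    HasDerivAt (fun t : ℝ => gibbsState β (H + (t : ℂ) • V) O)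
      (-(β : ℂ) * (duhamel β (H + (t₀ : ℂ) • V) O V -
        gibbsState β (H + (t₀ : ℂ) • V) O * gibbsState β (H + (t₀ : ℂ) • V) V)) t₀ := by
  set H₀ : Matrix m m ℂ := H + (t₀ : ℂ) • V with hH₀
  have hH₀h : H₀.IsHermitian := by
    refine hH.add ?_
    unfold Matrix.IsHermitian
    rw [conjTranspose_smul, hV.eq, Complex.star_def, Complex.conj_ofReal]
  have hZ : partitionFn β H₀ ≠ 0 := by
    rw [hH₀h.partitionFn_eq_ofReal]
    exact_mod_cast (hH₀h.sum_exp_pos β).ne'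
  have h0 := hasDerivAt_gibbsState_add_smul_real β hZ V O
  -- translate: `t ↦ t - t₀`
  have hsub : HasDerivAt (fun t : ℝ => t - t₀) 1 t₀ := (hasDerivAt_id t₀).sub_const t₀
  have hcomp := HasDerivAt.scomp (𝕜 := ℝ) t₀
    (h := fun t : ℝ => t - t₀) (g₁ := fun t : ℝ => gibbsState β (H₀ + (t : ℂ) • V) O)
    (by rw [sub_self]; exact h0) hsub
  simp only [one_smul] at hcomp
  refine hcomp.congr_of_eventuallyEq (Eventually.of_forall fun t => ?_)
  simp only [Function.comp_apply, hH₀]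
  congr 2
  rw [add_assoc, ← add_smul]
  congr 1
  push_cast
  ring

/-! ### The perturbation bound -/

/-- **Gibbs expectations are Lipschitz in the Hamiltonian.** For Hermitian `H`, `V`, `β ≥ 0` and any
`O`: `‖⟨O⟩_{β,H+V} - ⟨O⟩_{β,H}‖ ≤ 2 β ‖V‖ ‖O‖` (operator norms). Proof: along `t ↦ H + tV`,
`t ∈ [0,1]`, the derivative `-β[(O,V)_Duh - ⟨O⟩⟨V⟩]` (`hasDerivAt_gibbsState_add_smul_real_at`) has
norm `≤ β(‖O‖‖V‖ + ‖O‖‖V‖)` (`norm_duhamel_le`, `norm_gibbsState_le`); mean value inequality.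
[cite: BratteliRobinsonII1997, Prop. 5.4.1] -/
theorem norm_gibbsState_add_sub_gibbsState_le {H V : Matrix m m ℂ} (hH : H.IsHermitian)
    (hV : V.IsHermitian) [Nonempty m] {β : ℝ} (hβ : 0 ≤ β) (O : Matrix m m ℂ) :
    ‖gibbsState β (H + V) O - gibbsState β H O‖ ≤ 2 * β * ‖V‖ * ‖O‖ := by
  set f : ℝ → ℂ := fun t => gibbsState β (H + (t : ℂ) • V) O with hf
  set f' : ℝ → ℂ := fun t => -(β : ℂ) * (duhamel β (H + (t : ℂ) • V) O V -
    gibbsState β (H + (t : ℂ) • V) O * gibbsState β (H + (t : ℂ) • V) V) with hf'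
  have hHt : ∀ t : ℝ, (H + (t : ℂ) • V).IsHermitian := fun t => by
    refine hH.add ?_
    unfold Matrix.IsHermitian
    rw [conjTranspose_smul, hV.eq, Complex.star_def, Complex.conj_ofReal]
  have hderiv : ∀ t ∈ Set.Icc (0 : ℝ) 1, HasDerivWithinAt f (f' t) (Set.Icc (0 : ℝ) 1) t :=
    fun t _ => (hasDerivAt_gibbsState_add_smul_real_at hH hV β t O).hasDerivWithinAt
  have hbound : ∀ t ∈ Set.Ico (0 : ℝ) 1, ‖f' t‖ ≤ 2 * β * ‖V‖ * ‖O‖ := by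
    intro t _
    have h1 : ‖duhamel β (H + (t : ℂ) • V) O V‖ ≤ ‖O‖ * ‖V‖ := norm_duhamel_le (hHt t) hβ O V
    have h2 : ‖gibbsState β (H + (t : ℂ) • V) O‖ ≤ ‖O‖ := norm_gibbsState_le (hHt t) β O
    have h3 : ‖gibbsState β (H + (t : ℂ) • V) V‖ ≤ ‖V‖ := norm_gibbsState_le (hHt t) β V
    have hβn : ‖-(β : ℂ)‖ = β := by rw [norm_neg, Complex.norm_real, Real.norm_of_nonneg hβ]
    calc ‖f' t‖ = ‖-(β : ℂ)‖ * ‖duhamel β (H + (t : ℂ) • V) O V -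
            gibbsState β (H + (t : ℂ) • V) O * gibbsState β (H + (t : ℂ) • V) V‖ := norm_mul _ _
      _ ≤ β * (‖O‖ * ‖V‖ + ‖O‖ * ‖V‖) := by
          rw [hβn]
          refine mul_le_mul_of_nonneg_left ((norm_sub_le _ _).trans (add_le_add h1 ?_)) hβ
          rw [norm_mul]
          exact mul_le_mul h2 h3 (norm_nonneg _) (norm_nonneg _)
      _ = 2 * β * ‖V‖ * ‖O‖ := by ring
  have key := norm_image_sub_le_of_norm_deriv_le_segment' hderiv hbound 1
    (Set.right_mem_Icc.mpr zero_le_one)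
  have hf1 : f 1 = gibbsState β (H + V) O := by simp [hf]
  have hf0 : f 0 = gibbsState β H O := by simp [hf]
  rw [hf1, hf0, sub_zero, mul_one] at key
  exact key

/-- Real-part form: `|Re ⟨O⟩_{β,H+V} - Re ⟨O⟩_{β,H}| ≤ 2 β ‖V‖ ‖O‖`. [cite: BratteliRobinsonII1997, Prop. 5.4.1] -/
theorem abs_re_gibbsState_add_sub_re_gibbsState_le {H V : Matrix m m ℂ} (hH : H.IsHermitian)
    (hV : V.IsHermitian) [Nonempty m] {β : ℝ} (hβ : 0 ≤ β) (O : Matrix m m ℂ) :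
    |(gibbsState β (H + V) O).re - (gibbsState β H O).re| ≤ 2 * β * ‖V‖ * ‖O‖ := by
  rw [← Complex.sub_re]
  exact (Complex.abs_re_le_norm _).trans (norm_gibbsState_add_sub_gibbsState_le hH hV hβ O)

end Matrix

end
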